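import Literature.Computability.Complexity.OccurrenceObstructionsBIP
import Literature.Computability.AlgebraicComplexity.MultiplicityObstructionsProofs
import Literature.NumberTheory.DiophantineGeometry.GLPolynomialRepSemisimpleProofs
import HarnessLib

/-!
# The Hermite–Hadamard–Howe pullback `k[Sym^m k^m] → k[Mat_m]` along products of linear forms

For the Chow variety `Chow_m = {ℓ_1 ⋯ ℓ_m} = \overline{GL_m · X_0 ⋯ X_{m-1}} ⊆ Sym^m k^m`
(Bürgisser–Hüttenhain–Ikenmeyer, Proc. AMS 145 (2017) = arXiv:1501.05528, §3: the product map
`φ_n : V^n → Chow_n, (v_1,…,v_n) ↦ v_1⋯v_n`, "surjective and `G`-equivariant", and its comorphism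
`φ_n^* : 𝒪(Chow_n) → 𝒪(V^n)`; Landsberg, *Geometric complexity theory: an introduction for
geometers*, Ann. Univ. Ferrara 61 (2015) = arXiv:1305.7387, §7.2 and Prop. 7.4 (Hadamard): the map
`h_{d,n} : S^d(S^n W) → S^n(S^d W)` with `ker h_{d,n} = I_d(Ch_n(W^*))`, and §7.6, Prop. 7.7:
`h̃_{d,n} = ψ_n^*` is the comorphism of the product map) this file sets up, over a field `k`:

* `genericProduct m = ∏_j (∑_i X_{(i,j)} X_i)`, the product of `m` generic linear forms in the `m`
  variables, with coefficients in the polynomial ring `k[Mat_m] = MvPolynomial (Fin m × Fin m) k`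
  (the variable `X (i, j)` is the coefficient of `X_i` in the `j`-th form: the entries of the
  `m × m` matrix whose COLUMNS are the forms);
* `chowPullback m : k[Sym^m k^m] →ₐ[k] k[Mat_m]`, `F ↦ F(ℓ_1 ⋯ ℓ_m)` — BHI's comorphism `φ_m^*`
  on `𝒪(W) = k[Sym^m]`, whose corestriction to the `H_m`-invariants is the Hermite–Hadamard–Howe
  map (Landsberg Prop. 7.7). It is DEFINED as the tree's generic orbit map
  `genericOrbitMap (∏ i, X i) m` (`OrbitClosureWeights.lean`: `X_d ↦ coeff_d (Y · f)` for the
  generic matrix `Y`), of which `genericProduct` is the unfolding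
  (`chowPullback_eq_aeval_genericProduct`); `eval_chowPullback`: its value at a numerical matrix
  `w` is `F` at the product of the forms;
* `formsRep m`, the representation of `GL_m` on `k[Mat_m]` by `(g · G)(w) = G(g⁻¹ w)` (the
  substitution by the block-diagonal matrix `diag((g⁻¹)ᵀ, …, (g⁻¹)ᵀ)` on the variable index), for
  which `chowPullback` is equivariant (`chowPullback_coordSubst`, BHI: "`φ_n` is `G`-equivariant");
* PROVED: the pullback of `F` is nonzero iff `F` does not vanish on the orbit `GL_m · X_0⋯X_{m-1}`
  (`chowPullback_ne_zero_iff`, Hadamard's `ker h_{d,n} = I_d(Ch_n)`; this is the tree's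
  `orbitVanishingIdeal_eq_ker_genericOrbitMap`), hence a highest-weight vector with nonzero
  pullback makes its weight occur in `k[Chow_m]`
  (`hasHighestWeight_orbitCoordRep_prod_X_of_chowPullback_ne_zero`); and, in characteristic zero,
  every highest-weight vector of `k[Mat_m]` (for `formsRep`) lying in the image of the pullback is
  the pullback of a highest-weight vector of `k[Sym^m k^m]` of the same weight
  (`exists_mem_highestWeightSpace_chowPullback_eq`, complete reducibility of `k[Sym^m]` via the
  tree's `map_highestWeightSpace_eq_of_surjective`), so that its weight occurs in `k[Chow_m]`
  (`hasHighestWeight_orbitCoordRep_prod_X_of_mem_range`).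

This is the first file of a formalisation of BHI's Theorem 3 (the saturation of the monoid of
representations of the Chow variety) through the finiteness of the cokernel of the
Hermite–Hadamard–Howe map (Brion); the monoid `S(Chow_m)` itself is
`Literature.Barriers.ValiantsHypothesis.chowOccWeights` (`NotViaSaturationsChow.lean`, whose
`chowMonomial k m` is the `∏ i, X i` of this file).

## References

* [BurgisserHuttenhainIkenmeyer2017] §3 (`φ_n`, `ψ_n`, Lemma 2).
* J. M. Landsberg, arXiv:1305.7387, §7.2 (Prop. 7.4), §7.6 (Prop. 7.7).
-/

noncomputable section

open MvPolynomial
open scoped Matrix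

namespace Literature.Computability.AlgebraicComplexity

open Literature.NumberTheory.DiophantineGeometry

variable {k : Type*} [Field k] (m : ℕ)

/-! ### Generic linear forms and the pullback -/

/-- The `j`-th generic linear form `ℓ_j = ∑_i X_{(i,j)} X_i` in the `m` variables, with
coefficients the coordinate functions `X (i, j)` of `k[Mat_m]` (column `j` of the matrix).
[cite: BurgisserHuttenhainIkenmeyer2017, §3 (the product map φ_n)] -/
def genericLinForm (j : Fin m) : MvPolynomial (Fin m) (MvPolynomial (Fin m × Fin m) k) :=
  ∑ i : Fin m, C (X (i, j)) * X i

/-- The product `ℓ_0 ⋯ ℓ_{m-1}` of the `m` generic linear forms: the generic point of the Chow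
variety, `φ_m(v_1, …, v_m) = v_1 ⋯ v_m` with indeterminate `v_j`.
[cite: BurgisserHuttenhainIkenmeyer2017, §3 (the product map φ_n)] -/
def genericProduct : MvPolynomial (Fin m) (MvPolynomial (Fin m × Fin m) k) :=
  ∏ j : Fin m, genericLinForm (k := k) m j

/-- **The pullback** `k[Sym^m k^m] → k[Mat_m]`, `F ↦ F(ℓ_0 ⋯ ℓ_{m-1})`: BHI's comorphism `φ_m^*`
of the product map on `𝒪(W) = k[Sym^m]` (whose corestriction to the `H_m`-invariants is the
Hermite–Hadamard–Howe map `h̃_{d,m} = h_{d,m}`, Landsberg Prop. 7.7), defined as the tree's generic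
orbit map of the Chow monomial `X_0 ⋯ X_{m-1}` (`genericOrbitMap`: the coordinate `X_d` goes to
`coeff_d (Y · X_0⋯X_{m-1})` for the generic matrix `Y`, i.e. to the coefficient of `X^d` in the
generic product, `chowPullback_X`). [cite: BurgisserHuttenhainIkenmeyer2017, §3 (comorphism of φ_n)] -/
def chowPullback : MvPolynomial (DegIdx (Fin m) m) k →ₐ[k] MvPolynomial (Fin m × Fin m) k :=
  genericOrbitMap (∏ i : Fin m, X i : MvPolynomial (Fin m) k) m

/-- The generic product is the generic-matrix substitution instance `Y · (X_0⋯X_{m-1})` of the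
Chow monomial. [folklore] -/
theorem genericProduct_eq_linSubst :
    genericProduct (k := k) m = linSubst (Fin m) (MvPolynomial (Fin m × Fin m) k)
      (Matrix.mvPolynomialX (Fin m) (Fin m) k)
      (MvPolynomial.map (C : k →+* MvPolynomial (Fin m × Fin m) k) (∏ i : Fin m, X i)) := by
  rw [map_prod, map_prod, genericProduct]
  refine Finset.prod_congr rfl fun j _ => ?_
  rw [map_X, linSubst_X, genericLinForm]
  refine Finset.sum_congr rfl fun i _ => ?_
  rw [Matrix.mvPolynomialX_apply, smul_eq_C_mul]

/-- The pullback, unfolded: `X_d ↦ coeff_d (ℓ_0 ⋯ ℓ_{m-1})`. [folklore] -/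
theorem chowPullback_eq_aeval_genericProduct :
    chowPullback (k := k) m = aeval fun d : DegIdx (Fin m) m => coeff d.1 (genericProduct (k := k) m) := by
  unfold chowPullback genericOrbitMap
  rw [genericProduct_eq_linSubst]

/-- The pullback of a coordinate function is a coefficient of the generic product. [folklore] -/
theorem chowPullback_X (d : DegIdx (Fin m) m) :
    chowPullback (k := k) m (X d) = coeff d.1 (genericProduct (k := k) m) := by
  rw [chowPullback_eq_aeval_genericProduct, aeval_X]

/-- The product of the `m` linear forms with numerical coefficient matrix `w` (columns = forms).
[cite: BurgisserHuttenhainIkenmeyer2017, §3 (Chow_n)] -/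
def linFormProd (w : Fin m × Fin m → k) : MvPolynomial (Fin m) k :=
  ∏ j : Fin m, ∑ i : Fin m, C (w (i, j)) * X i

/-- The product of linear forms with coefficient matrix `w` is the linear substitution instance
`w · (X_0 ⋯ X_{m-1})` of the Chow monomial (`linSubst`: `X_j ↦ ∑_i w_{ij} X_i`).
[cite: BurgisserHuttenhainIkenmeyer2017, §3 (Lemma 2: Chow_n ⊆ closure of G w_n)] -/
theorem linFormProd_eq_linSubst (w : Fin m × Fin m → k) :
    linFormProd m w = linSubst (Fin m) k (Matrix.of fun i j => w (i, j)) (∏ i : Fin m, X i) := by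
  rw [map_prod, linFormProd]
  refine Finset.prod_congr rfl fun j _ => ?_
  rw [linSubst_X]
  refine Finset.sum_congr rfl fun i _ => ?_
  rw [Matrix.of_apply, smul_eq_C_mul]

/-- **The value of the pullback**: `(chowPullback F)(w) = F(ℓ_0(w) ⋯ ℓ_{m-1}(w))`, the value of `F`
at the product of the linear forms with coefficient matrix `w` (the tree's `eval_genericOrbitMap`;
Landsberg Prop. 7.4: "`P(ℓ^1 ⋯ ℓ^n) = ⟨h_{d,n}(P), (ℓ^1)^d ⋯ (ℓ^n)^d⟩`").
[cite: BurgisserHuttenhainIkenmeyer2017, §3 (comorphism of φ_n)] -/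
theorem eval_chowPullback (w : Fin m × Fin m → k) (F : MvPolynomial (DegIdx (Fin m) m) k) :
    eval w (chowPullback m F) = aeval (formCoeff m (linFormProd m w)) F := by
  rw [chowPullback, linFormProd_eq_linSubst, ← eval_genericOrbitMap]
  rfl

/-- **The pullback of `F` is nonzero iff `F` does not vanish on the orbit `GL_m · X_0⋯X_{m-1}`**
(over an infinite field): Hadamard's "`ker h_{d,n} = I_d(Ch_n)`" (Landsberg Prop. 7.4), which for
the orbit map is the tree's `orbitVanishingIdeal_eq_ker_genericOrbitMap` (`GL` is Zariski dense in
`Mat`). [cite: BurgisserHuttenhainIkenmeyer2017, §3 (Lemma 2)] -/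
theorem chowPullback_ne_zero_iff [Infinite k] {F : MvPolynomial (DegIdx (Fin m) m) k} :
    chowPullback m F ≠ 0 ↔
      F ∉ orbitVanishingIdeal (∏ i : Fin m, X i : MvPolynomial (Fin m) k) m := by
  rw [orbitVanishingIdeal_eq_ker_genericOrbitMap, RingHom.mem_ker]
  rfl

/-- One direction of `chowPullback_ne_zero_iff`, named for convenience. [folklore] -/
theorem not_mem_orbitVanishingIdeal_of_chowPullback_ne_zero [Infinite k]
    {F : MvPolynomial (DegIdx (Fin m) m) k} (hF : chowPullback m F ≠ 0) :
    F ∉ orbitVanishingIdeal (∏ i : Fin m, X i : MvPolynomial (Fin m) k) m :=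
  (chowPullback_ne_zero_iff m).mp hF

/-- Hence **a highest-weight vector of `k[Sym^m k^m]` with nonzero pullback makes its weight occur
in `k[Chow_m]`** (the coordinate ring of the orbit closure of `X_0⋯X_{m-1}`).
[cite: BurgisserHuttenhainIkenmeyer2017, §3 (S(Chow_n))] -/
theorem hasHighestWeight_orbitCoordRep_prod_X_of_chowPullback_ne_zero [Infinite k]
    {χ : Weight (Fin m)} {F : MvPolynomial (DegIdx (Fin m) m) k}
    (hFw : F ∈ highestWeightSpace (coordRep (Fin m) k m) χ) (hF : chowPullback m F ≠ 0) :
    HasHighestWeight (orbitCoordRep (∏ i : Fin m, X i : MvPolynomial (Fin m) k) m) χ :=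
  Literature.Computability.Complexity.hasHighestWeight_orbitCoordRep_of_not_mem _ m hFw
    (not_mem_orbitVanishingIdeal_of_chowPullback_ne_zero m hF)

/-! ### The block action of `GL_m` on `k[Mat_m]` and the equivariance of the pullback -/

/-- The block-diagonal embedding `g ↦ diag((g⁻¹)ᵀ, …, (g⁻¹)ᵀ)` of `GL_m` into `GL_{m²}` (acting on
the variable index `i` of `X (i, j)`), a group homomorphism. [folklore] -/
def formsBlockGL : GL (Fin m) k →* GL (Fin m × Fin m) k where
  toFun g :=
    ⟨Matrix.blockDiagonal fun _ : Fin m => ((g⁻¹ : GL (Fin m) k) : Matrix (Fin m) (Fin m) k)ᵀ,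
     Matrix.blockDiagonal fun _ : Fin m => ((g : GL (Fin m) k) : Matrix (Fin m) (Fin m) k)ᵀ,
     by
      have h1 : ((g⁻¹ : GL (Fin m) k) : Matrix (Fin m) (Fin m) k)ᵀ *
          ((g : GL (Fin m) k) : Matrix (Fin m) (Fin m) k)ᵀ = 1 := by
        rw [← Matrix.transpose_mul, ← Units.val_mul, mul_inv_cancel, Units.val_one,
          Matrix.transpose_one]
      rw [← Matrix.blockDiagonal_mul]
      simp_rw [h1]
      exact Matrix.blockDiagonal_one,
     by
      have h1 : ((g : GL (Fin m) k) : Matrix (Fin m) (Fin m) k)ᵀ *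
          ((g⁻¹ : GL (Fin m) k) : Matrix (Fin m) (Fin m) k)ᵀ = 1 := by
        rw [← Matrix.transpose_mul, ← Units.val_mul, inv_mul_cancel, Units.val_one,
          Matrix.transpose_one]
      rw [← Matrix.blockDiagonal_mul]
      simp_rw [h1]
      exact Matrix.blockDiagonal_one⟩
  map_one' := by
    apply Units.ext
    change Matrix.blockDiagonal (fun _ : Fin m => (((1 : GL (Fin m) k)⁻¹ : GL (Fin m) k) :
      Matrix (Fin m) (Fin m) k)ᵀ) = 1
    rw [inv_one, Units.val_one, Matrix.transpose_one]
    exact Matrix.blockDiagonal_one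
  map_mul' g h := by
    apply Units.ext
    change Matrix.blockDiagonal (fun _ : Fin m => (((g * h)⁻¹ : GL (Fin m) k) :
        Matrix (Fin m) (Fin m) k)ᵀ) =
      Matrix.blockDiagonal (fun _ : Fin m => ((g⁻¹ : GL (Fin m) k) : Matrix (Fin m) (Fin m) k)ᵀ) *
        Matrix.blockDiagonal (fun _ : Fin m => ((h⁻¹ : GL (Fin m) k) : Matrix (Fin m) (Fin m) k)ᵀ)
    rw [← Matrix.blockDiagonal_mul, mul_inv_rev, Units.val_mul, Matrix.transpose_mul]

/-- The matrix of `formsBlockGL g` (unfolding lemma). [folklore] -/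
@[simp]
theorem coe_formsBlockGL (g : GL (Fin m) k) :
    ((formsBlockGL m g : GL (Fin m × Fin m) k) : Matrix (Fin m × Fin m) (Fin m × Fin m) k) =
      Matrix.blockDiagonal fun _ : Fin m => ((g⁻¹ : GL (Fin m) k) : Matrix (Fin m) (Fin m) k)ᵀ :=
  rfl

/-- **The representation of `GL_m` on `k[Mat_m] = 𝒪(V^m)`**, `(g · G)(w) = G(g⁻¹ w)` (the action on
regular functions induced by the diagonal action of `GL_m` on the `m` linear forms, BHI §2:
"`(g F)(z) := F(g⁻¹ z)`"): linear substitution by `formsBlockGL g`.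
[cite: BurgisserHuttenhainIkenmeyer2017, §1 ((gF)(z) = F(g⁻¹z)) and §3 (G-action on V^n)] -/
def formsRep : Representation k (GL (Fin m) k) (MvPolynomial (Fin m × Fin m) k) :=
  (linSubstRep (Fin m × Fin m) k).comp (formsBlockGL m)

/-- `formsRep` on a variable: `X (i', j) ↦ ∑_i (g⁻¹)_{i' i} X (i, j)`. [folklore] -/
theorem formsRep_X (g : GL (Fin m) k) (i' j : Fin m) :
    formsRep m g (X (i', j)) =
      ∑ i : Fin m, ((g⁻¹ : GL (Fin m) k) : Matrix (Fin m) (Fin m) k) i' i • X (i, j) := by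
  change linSubstRep (Fin m × Fin m) k (formsBlockGL m g) (X (i', j)) = _
  rw [linSubstRep_apply, linSubst_X, coe_formsBlockGL, ← Finset.univ_product_univ, Finset.sum_product,
    Finset.sum_comm]
  refine (Finset.sum_eq_single j (fun j₂ _ hj => ?_) (fun h => absurd (Finset.mem_univ j) h)).trans
    ?_
  · exact Finset.sum_eq_zero fun i _ => by
      rw [Matrix.blockDiagonal_apply_ne _ _ _ hj, zero_smul]
  · refine Finset.sum_congr rfl fun i _ => ?_
    rw [Matrix.blockDiagonal_apply_eq, Matrix.transpose_apply]

/-- `formsRep g` is the algebra endomorphism `linSubst` by the block matrix (unfolding lemma).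
[folklore] -/
theorem formsRep_apply (g : GL (Fin m) k) (G : MvPolynomial (Fin m × Fin m) k) :
    formsRep m g G =
      linSubst (Fin m × Fin m) k ((formsBlockGL m g : GL (Fin m × Fin m) k) : Matrix _ _ k) G :=
  rfl

/-- The matrix-vector bookkeeping of the block action: column `u` of the block matrix against
`w` is `(g⁻¹ w)_u`. [folklore] -/
theorem sum_formsBlockGL_mul (g : GL (Fin m) k) (w : Fin m × Fin m → k) (u : Fin m × Fin m) :
    ∑ v : Fin m × Fin m,
        ((formsBlockGL m g : GL (Fin m × Fin m) k) : Matrix (Fin m × Fin m) (Fin m × Fin m) k) v u * w v =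
      ∑ i : Fin m, ((g⁻¹ : GL (Fin m) k) : Matrix (Fin m) (Fin m) k) u.1 i * w (i, u.2) := by
  rcases u with ⟨i', j⟩
  rw [coe_formsBlockGL, Fintype.sum_prod_type, Finset.sum_comm]
  refine (Finset.sum_eq_single j (fun j₂ _ hj => ?_) (fun h => absurd (Finset.mem_univ j) h)).trans
    ?_
  · exact Finset.sum_eq_zero fun i _ => by
      rw [Matrix.blockDiagonal_apply_ne _ _ _ hj, zero_mul]
  · refine Finset.sum_congr rfl fun i _ => ?_
    rw [Matrix.blockDiagonal_apply_eq, Matrix.transpose_apply]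

/-- **Values of the block action**: `(g · G)(w) = G(w')` with `w'_{i'j} = ∑_i (g⁻¹)_{i' i} w_{ij}`,
i.e. `w' = g⁻¹ w`. [cite: BurgisserHuttenhainIkenmeyer2017, §1 ((gF)(z) = F(g⁻¹z))] -/
theorem eval_formsRep (g : GL (Fin m) k) (w : Fin m × Fin m → k)
    (G : MvPolynomial (Fin m × Fin m) k) :
    eval w (formsRep m g G) =
      eval (fun v : Fin m × Fin m =>
        ∑ i : Fin m, ((g⁻¹ : GL (Fin m) k) : Matrix (Fin m) (Fin m) k) v.1 i * w (i, v.2)) G := by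
  have hfun : (fun u : Fin m × Fin m => ∑ v : Fin m × Fin m,
      ((formsBlockGL m g : GL (Fin m × Fin m) k) : Matrix (Fin m × Fin m) (Fin m × Fin m) k) v u * w v) =
      fun v : Fin m × Fin m =>
        ∑ i : Fin m, ((g⁻¹ : GL (Fin m) k) : Matrix (Fin m) (Fin m) k) v.1 i * w (i, v.2) :=
    funext fun u => sum_formsBlockGL_mul m g w u
  rw [formsRep_apply, Literature.Computability.Complexity.eval_linSubst, hfun]

/-- A linear substitution of the product of linear forms with coefficients `w` is the product of
the linear forms with coefficients `A w`. [folklore] -/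
theorem linSubst_linFormProd (A : Matrix (Fin m) (Fin m) k) (w : Fin m × Fin m → k) :
    linSubst (Fin m) k A (linFormProd m w) =
      linFormProd m (fun v : Fin m × Fin m => ∑ i : Fin m, A v.1 i * w (i, v.2)) := by
  rw [linFormProd, linFormProd, map_prod]
  refine Finset.prod_congr rfl fun j _ => ?_
  rw [map_sum]
  have hterm : ∀ i : Fin m, linSubst (Fin m) k A (C (w (i, j)) * X i) =
      ∑ i' : Fin m, C (A i' i * w (i, j)) * X i' := fun i => by
    rw [map_mul, linSubst_C, linSubst_X, Finset.mul_sum]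
    refine Finset.sum_congr rfl fun i' _ => ?_
    rw [smul_eq_C_mul, ← mul_assoc, ← map_mul, mul_comm (w (i, j))]
  simp_rw [hterm]
  rw [Finset.sum_comm]
  refine Finset.sum_congr rfl fun i' _ => ?_
  rw [map_sum, Finset.sum_mul]

/-- The product of linear forms with coefficients `w`, substituted by `g⁻¹`, is the product of the
linear forms with coefficients `g⁻¹ w`. [folklore] -/
theorem linSubstRep_inv_linFormProd (g : GL (Fin m) k) (w : Fin m × Fin m → k) :
    linSubstRep (Fin m) k g⁻¹ (linFormProd m w) =
      linFormProd m (fun v : Fin m × Fin m =>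
        ∑ i : Fin m, ((g⁻¹ : GL (Fin m) k) : Matrix (Fin m) (Fin m) k) v.1 i * w (i, v.2)) :=
  linSubst_linFormProd m _ w

/-- **The pullback is `GL_m`-equivariant** (BHI §3: "`φ_n` is surjective and `G`-equivariant"):
`chowPullback (g · F) = g · chowPullback F`, i.e. `F(g⁻¹·(ℓ_0⋯ℓ_{m-1})) = F((g⁻¹ℓ_0)⋯(g⁻¹ℓ_{m-1}))`
(checked on values at every matrix `w`, over an infinite field).
[cite: BurgisserHuttenhainIkenmeyer2017, §3 (φ_n is G-equivariant)] -/
theorem chowPullback_coordSubst [Infinite k] (g : GL (Fin m) k)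
    (F : MvPolynomial (DegIdx (Fin m) m) k) :
    chowPullback m (coordSubst m g F) = formsRep m g (chowPullback m F) := by
  apply MvPolynomial.funext
  intro w
  rw [eval_chowPullback, aeval_formCoeff_coordSubst, eval_formsRep, eval_chowPullback,
    linSubstRep_inv_linFormProd]

/-- The pullback as an intertwining map `coordRep (Fin m) k m ⟶ formsRep m` (over an infinite
field). [cite: BurgisserHuttenhainIkenmeyer2017, §3 (φ_n^* is a morphism of G-modules)] -/
def chowPullbackIntertwining [Infinite k] :
    (coordRep (Fin m) k m).IntertwiningMap (formsRep (k := k) m) where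
  toLinearMap := (chowPullback (k := k) m).toLinearMap
  isIntertwining' g := LinearMap.ext fun F => chowPullback_coordSubst m g F

/-- Unfolding lemma for `chowPullbackIntertwining`. [folklore] -/
@[simp]
theorem chowPullbackIntertwining_apply [Infinite k] (F : MvPolynomial (DegIdx (Fin m) m) k) :
    chowPullbackIntertwining (k := k) m F = chowPullback m F :=
  rfl

/-! ### Lifting highest-weight vectors through the pullback (characteristic zero) -/

/-- **Highest-weight vectors in the image of the pullback lift**: in characteristic zero, a
highest-weight vector `G` of `k[Mat_m]` (for `formsRep`) of weight `χ` lying in the image of the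
pullback is the pullback of a highest-weight vector of `k[Sym^m k^m]` of weight `χ` — the
highest-weight space of the image is the image of the highest-weight space, by complete reducibility
of `k[Sym^m]` (`isSemisimpleRepresentation_coordRep`, `map_highestWeightSpace_eq_of_surjective`).
This is the representation-theoretic input ("Schur's lemma") of BHI's Prop. 1 / §1 (2) in the form
needed for the normalisation `V^n // H_n → Chow_n`.
[cite: BurgisserHuttenhainIkenmeyer2017, §1 (Schur's-lemma remark after (1)) and §2 Prop. 1] -/
theorem exists_mem_highestWeightSpace_chowPullback_eq [CharZero k] {χ : Weight (Fin m)}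
    {G : MvPolynomial (Fin m × Fin m) k} (hGw : G ∈ highestWeightSpace (formsRep m) χ)
    (hGr : G ∈ (chowPullback (k := k) m).range) :
    ∃ F ∈ highestWeightSpace (coordRep (Fin m) k m) χ, chowPullback m F = G := by
  have hsurj := intertwiningRangeRestrict_surjective (chowPullbackIntertwining (k := k) m)
  have hmap := map_highestWeightSpace_eq_of_surjective _ hsurj
    (isSemisimpleRepresentation_coordRep m) χ
  -- `G` as an element of the range, a highest-weight vector of the range representation
  obtain ⟨F₀, hF₀⟩ := (AlgHom.mem_range _).mp hGr
  have hGmem : G ∈ (chowPullbackIntertwining (k := k) m).range.toSubmodule := ⟨F₀, hF₀⟩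
  have hGhw : (⟨G, hGmem⟩ : ↥(chowPullbackIntertwining (k := k) m).range.toSubmodule) ∈
      highestWeightSpace (chowPullbackIntertwining (k := k) m).range.toRepresentation χ := by
    intro b hb
    apply Subtype.ext
    exact hGw b hb
  rw [← hmap] at hGhw
  obtain ⟨F, hF, hFG⟩ := Submodule.mem_map.mp hGhw
  exact ⟨F, hF, congrArg Subtype.val hFG⟩

/-- **Occurrence in `k[Chow_m]` from a highest-weight vector of `k[Mat_m]` in the image of the
pullback** (characteristic zero): if a nonzero `G ∈ k[Mat_m]` is a highest-weight vector of
weight `χ` for `formsRep` and lies in the image of `chowPullback`, then `χ` occurs in the coordinate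
ring of the orbit closure of `X_0⋯X_{m-1}`. [cite: BurgisserHuttenhainIkenmeyer2017, §3 (S(Chow_n) and its normalisation)] -/
theorem hasHighestWeight_orbitCoordRep_prod_X_of_mem_range [CharZero k] {χ : Weight (Fin m)}
    {G : MvPolynomial (Fin m × Fin m) k} (hGw : G ∈ highestWeightSpace (formsRep m) χ)
    (hGr : G ∈ (chowPullback (k := k) m).range) (hG0 : G ≠ 0) :
    HasHighestWeight (orbitCoordRep (∏ i : Fin m, X i : MvPolynomial (Fin m) k) m) χ := by
  obtain ⟨F, hF, hFG⟩ := exists_mem_highestWeightSpace_chowPullback_eq m hGw hGr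
  refine hasHighestWeight_orbitCoordRep_prod_X_of_chowPullback_ne_zero m hF ?_
  rw [hFG]
  exact hG0

end Literature.Computability.AlgebraicComplexity
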